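import Summits.CriticalPhenomena.PercolationContinuityZ3.Theorems.PercNearOneGluingNoHeavyLowerTailAPLVwEasy
import HarnessLib

/-!
# `NoHeavyLowerTail` (stmt-CriticalPhenomena-4575) — the per-vertex inequality (PV) at a single loaded vertex IS a
# Delfino–Viti-type three-point inequality with constant 2

Support file (prover prim-ineq-gen-8 gen 46; `--supports stmt-CriticalPhenomena-4575`; memo
run/shared/lean/prim/prim-ineq-gen-8/FINDING-gen46-DVHARD.md §1).  No definitions, no named facts, no sorries.

SETTING (as in `…APLVwEasy.lean`, apex set `S = {s}`).  `μ = prodBernoulli w` on a finite vertex type, three vertices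
`s` (apex), `v`, `x`; put the load `ℓ = 1` at `x` and `0` elsewhere.  Then the quantities of (PV) at `(s, v)` are
  `N = Cov(1[s↔v], 1[s↔x]) = μ(s↔v ∩ s↔x) − μ(s↔v) μ(s↔x)`,
  `Γ = μ(s↔x)·μ(v↔x ∩ (s↔v)ᶜ) − μ(s↔x ∩ v↔x ∩ (s↔v)ᶜ)`,
and (PV) reads `N² ≤ 2 μ(s↔v) Γ` (the `x`-diagonal entry of the copositive form of memos gen 44/45).

THIS FILE proves [this work]:
* `pv_diag_iff_dv` (real algebra): `(u − γβ)² ≤ 2γ·β(α − u)  ↔  u² + γ²β² ≤ 2αβγ`;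
  `dv_sq_le_of_pv_diag`, `dv_sq_lt_two_of_pv_diag`: hence `u² ≤ 2αβγ − (βγ)²` and, for `βγ > 0`, `u² < 2αβγ`.
* `openConn_vx_inter_sv`, `openConn_sx_inter_vx_inter_not_sv` (set identities): `{v↔x} ∩ {s↔v} = {s↔v} ∩ {s↔x}` and
  `{s↔x} ∩ {v↔x} ∩ {s↔v}ᶜ = ∅` (transitivity of `↔`).
* **`pv_single_load_iff_dv`**: for every finite weighted graph, (PV) at `(s, v)` with the single load at `x` is EQUIVALENT to
  `μ(s↔v ∩ s↔x)² + μ(s↔v)² μ(s↔x)² ≤ 2 μ(s↔v) μ(s↔x) μ(v↔x)`;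
* **`dv_sq_lt_two_of_pv_single_load`**: consequently (PV) at `(s, v)` with the single load at `x` implies the Delfino–Viti-type
  bound `μ(s↔v↔x)² < 2 μ(s↔v) μ(s↔x) μ(v↔x)` whenever `μ(s↔v) μ(s↔x) > 0`.

WHY IT MATTERS (memo §1).  The conjecture "(PV) on every finite graph" (memos gen 42–45; proved on forests, on two-terminal
series–parallel graphs, and in the easy regime) therefore implies `P(a↔b↔c)² < 2 P(a↔b)P(a↔c)P(b↔c)` on EVERY finite graph,
i.e. a Delfino–Viti constant `< √2` uniformly.  The best published bound is `P(abc)² ≤ 8 P(ab)P(ac)P(bc)` (Gladkov,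
arXiv:2408.08457, Thm. 6.2), with `2` known only for planar graphs and `a, b, c` on one face (ibid., Thm. 6.1); so any proof of
(PV) for all graphs must improve that constant from `8` to `2`.  Conversely the `ε`-hanging construction of the memo shows that the
best constant in the `x`-diagonal of (PV) is at least `sup_G P(abc)²/(P(ab)P(ac)P(bc)) ≥ 1.06`.  The weaker conjectures (V_w), (V),
(Q0) do NOT have this feature (memo §2).
-/

noncomputable section

namespace Summit.CriticalPhenomena.PercolationContinuityZ3.Theorems

namespace APL

open MeasureTheory Set Literature.Probability.Percolation Literature.Probability.LatticeModels
open scoped Classical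

/-! ### Real algebra -/

/-- **The `x`-diagonal of (PV) is a three-point inequality.**  For reals `u, α, β, γ`
(read `u = μ(s↔v ∩ s↔x)`, `α = μ(v↔x)`, `β = μ(s↔x)`, `γ = μ(s↔v)`):
`(u − γβ)² ≤ 2γ·(β(α − u))  ↔  u² + γ²β² ≤ 2αβγ`. [this work] -/
theorem pv_diag_iff_dv (u α β γ : ℝ) :
    (u - γ * β) ^ 2 ≤ 2 * γ * (β * (α - u)) ↔ u ^ 2 + γ ^ 2 * β ^ 2 ≤ 2 * α * β * γ := by
  constructor <;> intro h <;> nlinarith [h]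

/-- From the `x`-diagonal of (PV): `u² ≤ 2αβγ − (γβ)²`. [this work] -/
theorem dv_sq_le_of_pv_diag (u α β γ : ℝ) (h : (u - γ * β) ^ 2 ≤ 2 * γ * (β * (α - u))) :
    u ^ 2 ≤ 2 * α * β * γ - (γ * β) ^ 2 := by
  nlinarith [h]

/-- From the `x`-diagonal of (PV), if `βγ > 0`: the Delfino–Viti-type bound `u² < 2αβγ`. [this work] -/
theorem dv_sq_lt_two_of_pv_diag (u α β γ : ℝ) (hβ : 0 < β) (hγ : 0 < γ)
    (h : (u - γ * β) ^ 2 ≤ 2 * γ * (β * (α - u))) :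
    u ^ 2 < 2 * α * β * γ := by
  have h1 := dv_sq_le_of_pv_diag u α β γ h
  have h2 : 0 < (γ * β) ^ 2 := by positivity
  linarith

/-! ### Set identities: transitivity of `↔` -/

variable {V : Type*}

/-- `{v↔x} ∩ {s↔v} = {s↔v} ∩ {s↔x}`: given `s↔v`, the events `v↔x` and `s↔x` coincide. [this work] -/
theorem openConn_vx_inter_sv (s v x : V) :
    (openConn v x : Set (BondConfig V)) ∩ (openConn s v : Set (BondConfig V)) =
      (openConn s v : Set (BondConfig V)) ∩ (openConn s x : Set (BondConfig V)) := by
  ext ω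
  simp only [Set.mem_inter_iff]
  constructor
  · rintro ⟨hvx, hsv⟩
    exact ⟨hsv, SimpleGraph.Reachable.trans hsv hvx⟩
  · rintro ⟨hsv, hsx⟩
    exact ⟨SimpleGraph.Reachable.trans (SimpleGraph.Reachable.symm hsv) hsx, hsv⟩

/-- `{s↔x} ∩ {v↔x} ∩ {s↔v}ᶜ = ∅`: `s↔x` and `v↔x` force `s↔v`. [this work] -/
theorem openConn_sx_inter_vx_inter_not_sv (s v x : V) :
    (openConn s x : Set (BondConfig V)) ∩ (openConn v x : Set (BondConfig V)) ∩ (openConn s v : Set (BondConfig V))ᶜ = ∅ := by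
  ext ω
  constructor
  · rintro ⟨⟨hsx, hvx⟩, hnsv⟩
    exact (hnsv (SimpleGraph.Reachable.trans hsx (SimpleGraph.Reachable.symm hvx))).elim
  · intro h
    simp at h

/-! ### The percolation statement -/

variable [Fintype V] (w : Sym2 V → unitInterval) (s v x : V)

/-- **(PV) at a single loaded vertex ⟺ a three-point inequality with constant 2.**  For bond percolation `prodBernoulli w` on a
finite weighted graph and vertices `s` (apex), `v`, `x`: the per-vertex inequality (PV) at `(s, v)` for the load `1[· = x]`, namely
`(μ(s↔v ∩ s↔x) − μ(s↔v)μ(s↔x))² ≤ 2 μ(s↔v)·(μ(s↔x) μ(v↔x ∩ (s↔v)ᶜ) − μ(s↔x ∩ v↔x ∩ (s↔v)ᶜ))`, is equivalent to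
`μ(s↔v ∩ s↔x)² + μ(s↔v)² μ(s↔x)² ≤ 2 μ(v↔x) μ(s↔x) μ(s↔v)`. [this work] -/
theorem pv_single_load_iff_dv :
    ((prodBernoulli w).real ((openConn s v : Set (BondConfig V)) ∩ (openConn s x : Set (BondConfig V))) -
          (prodBernoulli w).real (openConn s v : Set (BondConfig V)) *
            (prodBernoulli w).real (openConn s x : Set (BondConfig V))) ^ 2 ≤
        2 * (prodBernoulli w).real (openConn s v : Set (BondConfig V)) *
          ((prodBernoulli w).real (openConn s x : Set (BondConfig V)) *
              (prodBernoulli w).real ((openConn v x : Set (BondConfig V)) ∩ (openConn s v : Set (BondConfig V))ᶜ) -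
            (prodBernoulli w).real ((openConn s x : Set (BondConfig V)) ∩ (openConn v x : Set (BondConfig V)) ∩
              (openConn s v : Set (BondConfig V))ᶜ)) ↔
      (prodBernoulli w).real ((openConn s v : Set (BondConfig V)) ∩ (openConn s x : Set (BondConfig V))) ^ 2 +
          (prodBernoulli w).real (openConn s v : Set (BondConfig V)) ^ 2 *
            (prodBernoulli w).real (openConn s x : Set (BondConfig V)) ^ 2 ≤
        2 * (prodBernoulli w).real (openConn v x : Set (BondConfig V)) *
          (prodBernoulli w).real (openConn s x : Set (BondConfig V)) *
            (prodBernoulli w).real (openConn s v : Set (BondConfig V)) := by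
  set μ := prodBernoulli w with hμ
  -- `μ(s↔x ∩ v↔x ∩ (s↔v)ᶜ) = 0`
  have h0 : μ.real ((openConn s x : Set (BondConfig V)) ∩ (openConn v x : Set (BondConfig V)) ∩
      (openConn s v : Set (BondConfig V))ᶜ) = 0 := by
    rw [openConn_sx_inter_vx_inter_not_sv s v x, measureReal_empty]
  -- `μ(v↔x ∩ (s↔v)ᶜ) = μ(v↔x) − μ(s↔v ∩ s↔x)`
  have h1 : μ.real ((openConn v x : Set (BondConfig V)) ∩ (openConn s v : Set (BondConfig V))ᶜ) =
      μ.real (openConn v x : Set (BondConfig V)) -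
        μ.real ((openConn s v : Set (BondConfig V)) ∩ (openConn s x : Set (BondConfig V))) := by
    have h := measureReal_inter_add_sdiff (μ := μ) (s := (openConn v x : Set (BondConfig V)))
      (t := (openConn s v : Set (BondConfig V))) MeasurableSet.of_discrete (measure_ne_top μ _)
    rw [Set.sdiff_eq, openConn_vx_inter_sv s v x] at h
    linarith
  rw [h0, h1, sub_zero]
  exact pv_diag_iff_dv _ _ _ _

/-- **(PV) ⟹ a Delfino–Viti constant `< √2`.**  If (PV) holds at `(s, v)` for the single load at `x` and
`μ(s↔v) μ(s↔x) > 0`, then `μ(s↔v ∩ s↔x)² < 2 μ(v↔x) μ(s↔x) μ(s↔v)` — to be compared with Gladkov's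
`P(abc)² ≤ 8 P(ab)P(ac)P(bc)` for general graphs (arXiv:2408.08457, Thm. 6.2). [this work] -/
theorem dv_sq_lt_two_of_pv_single_load
    (hpos : 0 < (prodBernoulli w).real (openConn s v : Set (BondConfig V)) *
      (prodBernoulli w).real (openConn s x : Set (BondConfig V)))
    (hpv : ((prodBernoulli w).real ((openConn s v : Set (BondConfig V)) ∩ (openConn s x : Set (BondConfig V))) -
          (prodBernoulli w).real (openConn s v : Set (BondConfig V)) *
            (prodBernoulli w).real (openConn s x : Set (BondConfig V))) ^ 2 ≤
        2 * (prodBernoulli w).real (openConn s v : Set (BondConfig V)) *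
          ((prodBernoulli w).real (openConn s x : Set (BondConfig V)) *
              (prodBernoulli w).real ((openConn v x : Set (BondConfig V)) ∩ (openConn s v : Set (BondConfig V))ᶜ) -
            (prodBernoulli w).real ((openConn s x : Set (BondConfig V)) ∩ (openConn v x : Set (BondConfig V)) ∩
              (openConn s v : Set (BondConfig V))ᶜ))) :
    (prodBernoulli w).real ((openConn s v : Set (BondConfig V)) ∩ (openConn s x : Set (BondConfig V))) ^ 2 <
      2 * (prodBernoulli w).real (openConn v x : Set (BondConfig V)) *
        (prodBernoulli w).real (openConn s x : Set (BondConfig V)) *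
          (prodBernoulli w).real (openConn s v : Set (BondConfig V)) := by
  have h := (pv_single_load_iff_dv w s v x).1 hpv
  have hγ : 0 ≤ (prodBernoulli w).real (openConn s v : Set (BondConfig V)) := measureReal_nonneg
  have hβ : 0 ≤ (prodBernoulli w).real (openConn s x : Set (BondConfig V)) := measureReal_nonneg
  have h2 : 0 < ((prodBernoulli w).real (openConn s v : Set (BondConfig V)) *
      (prodBernoulli w).real (openConn s x : Set (BondConfig V))) ^ 2 := by positivity
  nlinarith [h, h2]

end APL

end Summit.CriticalPhenomena.PercolationContinuityZ3.Theorems
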